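import Summits.FinalStateConjecture.FinalStateConjecture.Theorems.PhotonSphereChannelsExteriorEnergy

/-!
# Route PhotonSphereChannels — finite speed of propagation for `C²` solutions of `u_tt − u_xx + V u = 0`

Fourth file of the energy–flux calculus (`PhotonSphereChannelsEnergyIdentity`,
`PhotonSphereChannelsEnergyInequalities`, `PhotonSphereChannelsExteriorEnergy`).  From the
domain-of-dependence energy inequalities (`V ≥ 0` differentiable) it derives UNIQUENESS on domains
of dependence: if the Cauchy data of a `C²` solution vanish on `[a, b]` at time `t₁`
(`u = u_t = 0` there), then `u = 0` on the double triangle `{a + |t − t₁| ≤ x ≤ b − |t − t₁|}`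
(`eq_zero_of_data_eq_zero`: the energy of trivial data is zero, the shrunken/expanded energies are
squeezed to zero, a continuous non-negative density with zero integral vanishes, so `u_t = 0` on
every level and `u` is constant along vertical segments; the apex by continuity).  The curried
corollary `curried_eq_zero_outside_cone` is stated with the data hypothesis of the route decl
`BlindnessInsidePhotonSphere` (data supported in `(x_e, x_c)` at `t = 0`): the solution vanishes
for `x ≥ x_c + |t|` and for `x ≤ x_e − |t|`.  Uses: the far/near channel integrands of the three
linear items vanish identically outside the light cone of the data, and solutions on the exterior
cone `{ρ + |t| < |x − x_c|}` are determined by their data on `{ρ < |x − x_c|}` (the kernel `P(ρ)`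
of `UniformPhotonSphereChannels`/`FixedModeChannels` is a statement about exterior data only).
Energy conservation for compactly supported data follows in
`PhotonSphereChannelsEnergyConservation`.  No new definitions; standard material [folklore].
-/

namespace Summit.FinalStateConjecture.FinalStateConjecture.Theorems

open MeasureTheory Set Filter Topology intervalIntegral

noncomputable section

namespace WaveEnergy

variable {u : ℝ × ℝ → ℝ} {V : ℝ → ℝ}

/-! ### Finite speed of propagation: uniqueness on domains of dependence -/

/-- With `V ≥ 0`, vanishing energy density forces `u_t = 0` and `u_x = 0`. -/
theorem fderiv_eq_zero_of_energyDensity_eq_zero (hV0 : ∀ x, 0 ≤ V x) {e : ℝ × ℝ → ℝ}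
    (he : ∀ z, e z = (fderiv ℝ u z (1, 0)) ^ 2 + (fderiv ℝ u z (0, 1)) ^ 2 + V z.2 * u z ^ 2)
    {z : ℝ × ℝ} (hz : e z = 0) :
    fderiv ℝ u z (1, 0) = 0 ∧ fderiv ℝ u z (0, 1) = 0 := by
  rw [he] at hz
  have h3 : 0 ≤ V z.2 * u z ^ 2 := mul_nonneg (hV0 z.2) (sq_nonneg _)
  have h1 : fderiv ℝ u z (1, 0) ^ 2 = 0 := by nlinarith [sq_nonneg (fderiv ℝ u z (0, 1))]
  have h2 : fderiv ℝ u z (0, 1) ^ 2 = 0 := by nlinarith [sq_nonneg (fderiv ℝ u z (1, 0))]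
  exact ⟨pow_eq_zero_iff (n := 2) (by norm_num) |>.mp h1,
    pow_eq_zero_iff (n := 2) (by norm_num) |>.mp h2⟩

/-- A continuous non-negative energy density with vanishing integral over a non-degenerate
interval vanishes on the closed interval. -/
theorem energyDensity_eq_zero_of_integral_eq_zero (hu : ContDiff ℝ 2 u) (hV : Differentiable ℝ V)
    (hV0 : ∀ x, 0 ≤ V x) {e : ℝ × ℝ → ℝ}
    (he : ∀ z, e z = (fderiv ℝ u z (1, 0)) ^ 2 + (fderiv ℝ u z (0, 1)) ^ 2 + V z.2 * u z ^ 2)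
    {p q t : ℝ} (hpq : p < q) (hint : (∫ x in p..q, e (t, x)) ≤ 0) {x : ℝ} (hx : x ∈ Icc p q) :
    e (t, x) = 0 := by
  have hec : Continuous fun y => e (t, y) :=
    (continuous_energyDensity hu hV he).comp (Continuous.prodMk_right t)
  have he0 := energyDensity_nonneg hV0 he
  by_contra hne
  have hpos : 0 < e (t, x) := lt_of_le_of_ne (he0 _) (Ne.symm hne)
  have := intervalIntegral.integral_pos hpq hec.continuousOn (fun y _ => he0 (t, y)) ⟨x, hx, hpos⟩
  linarith

/-- Trivial Cauchy data on `[a, b]`, `a ≤ b`, at time `t₁` (`u = 0`, `u_t = 0`) have zero energy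
there: `u_x (t₁, ·) = 0` on `[a, b]` as well, hence `∫_a^b e(t₁, ·) = 0`. -/
theorem integral_energy_eq_zero_of_data (hu : ContDiff ℝ 2 u) {e : ℝ × ℝ → ℝ}
    (he : ∀ z, e z = (fderiv ℝ u z (1, 0)) ^ 2 + (fderiv ℝ u z (0, 1)) ^ 2 + V z.2 * u z ^ 2)
    {a b t₁ : ℝ} (hab : a ≤ b) (h0 : ∀ x ∈ Icc a b, u (t₁, x) = 0)
    (h1 : ∀ x ∈ Icc a b, fderiv ℝ u (t₁, x) (1, 0) = 0) :
    (∫ x in a..b, e (t₁, x)) = 0 := by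
  rcases hab.lt_or_eq with hab | hab
  swap
  · subst hab
    simp
  · have hud := differentiable_of_contDiff_two hu
    -- `u_x (t₁, ·)` vanishes on the open interval, hence on the closed one by continuity
    have hux_open : ∀ x ∈ Ioo a b, fderiv ℝ u (t₁, x) (0, 1) = 0 := by
      intro x hx
      have hzero : (fun y => u (t₁, y)) =ᶠ[𝓝 x] fun _ => (0 : ℝ) := by
        filter_upwards [Ioo_mem_nhds hx.1 hx.2] with y hy
        exact h0 y (Ioo_subset_Icc_self hy)
      have hd : HasDerivAt (fun y => u (t₁, y)) 0 x :=
        (hasDerivAt_const x (0 : ℝ)).congr_of_eventuallyEq hzero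
      exact (hasDerivAt_slice_snd hud t₁ x).unique hd
    have hux : ∀ x ∈ Icc a b, fderiv ℝ u (t₁, x) (0, 1) = 0 := by
      have hcl : IsClosed {x : ℝ | fderiv ℝ u (t₁, x) (0, 1) = 0} :=
        isClosed_eq ((continuous_fderiv_apply hu (0, 1)).comp (Continuous.prodMk_right t₁))
          continuous_const
      have hsub : closure (Ioo a b) ⊆ {x : ℝ | fderiv ℝ u (t₁, x) (0, 1) = 0} :=
        hcl.closure_subset_iff.mpr hux_open
      rw [closure_Ioo hab.ne] at hsub
      exact fun x hx => hsub hx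
    have hez : ∀ x ∈ uIcc a b, e (t₁, x) = (fun _ => (0 : ℝ)) x := by
      intro x hx
      rw [uIcc_of_le hab.le] at hx
      simp only [he, h0 x hx, h1 x hx, hux x hx]
      ring
    rw [intervalIntegral.integral_congr hez]
    simp

/-- **Finite speed of propagation (non-degenerate levels).** If the Cauchy data of a `C²`
solution (`V ≥ 0` differentiable) vanish on `[a, b]` at time `t₁`, then `u (t, x) = 0` whenever
`a + |t − t₁| ≤ x ≤ b − |t − t₁|` and `a + |t − t₁| < b − |t − t₁|`. -/
theorem eq_zero_of_data_eq_zero_of_lt (hu : ContDiff ℝ 2 u) (hV : Differentiable ℝ V)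
    (hV0 : ∀ x, 0 ≤ V x)
    (hsol : ∀ z : ℝ × ℝ, fderiv ℝ (fderiv ℝ u) z (1, 0) (1, 0)
      - fderiv ℝ (fderiv ℝ u) z (0, 1) (0, 1) + V z.2 * u z = 0)
    {a b t₁ : ℝ} (h0 : ∀ x ∈ Icc a b, u (t₁, x) = 0)
    (h1 : ∀ x ∈ Icc a b, fderiv ℝ u (t₁, x) (1, 0) = 0) {t x : ℝ}
    (hlt : a + |t - t₁| < b - |t - t₁|) (hx1 : a + |t - t₁| ≤ x) (hx2 : x ≤ b - |t - t₁|) :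
    u (t, x) = 0 := by
  have he : ∀ z : ℝ × ℝ, (fun z : ℝ × ℝ =>
      (fderiv ℝ u z (1, 0)) ^ 2 + (fderiv ℝ u z (0, 1)) ^ 2 + V z.2 * u z ^ 2) z
      = (fderiv ℝ u z (1, 0)) ^ 2 + (fderiv ℝ u z (0, 1)) ^ 2 + V z.2 * u z ^ 2 := fun z => rfl
  have hab : a ≤ b := by linarith [abs_nonneg (t - t₁)]
  have hE0 := integral_energy_eq_zero_of_data hu he hab h0 h1
  -- `u_t` vanishes at every level `τ` between `t₁` and `t`, at the point `x`
  have hut : ∀ τ : ℝ, |τ - t₁| ≤ |t - t₁| → fderiv ℝ u (τ, x) (1, 0) = 0 := by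
    intro τ hτ
    have hltτ : a + |τ - t₁| < b - |τ - t₁| := by linarith
    have hle : (∫ y in (a + |τ - t₁|)..(b - |τ - t₁|),
        (fun z : ℝ × ℝ => (fderiv ℝ u z (1, 0)) ^ 2 + (fderiv ℝ u z (0, 1)) ^ 2
          + V z.2 * u z ^ 2) (τ, y)) ≤ 0 := by
      rcases le_or_gt t₁ τ with h | h
      · rw [abs_of_nonneg (sub_nonneg.mpr h)]
        exact (energy_shrinking_le hu hV hV0 hsol he a b h).trans hE0.le
      · rw [abs_of_neg (sub_neg.mpr h), neg_sub]
        have key := energy_le_expanding hu hV hV0 hsol he (a + (t₁ - τ)) (b - (t₁ - τ)) h.le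
        have e1 : a + (t₁ - τ) - (t₁ - τ) = a := by ring
        have e2 : b - (t₁ - τ) + (t₁ - τ) = b := by ring
        rw [e1, e2, hE0] at key
        exact key
    have hez := energyDensity_eq_zero_of_integral_eq_zero hu hV hV0 he hltτ hle
      (x := x) ⟨by linarith, by linarith⟩
    exact (fderiv_eq_zero_of_energyDensity_eq_zero hV0 he hez).1
  -- integrate `u_t = 0` along the vertical segment from `(t₁, x)` to `(t, x)`
  have hud := differentiable_of_contDiff_two hu
  have hg : ∀ τ, HasDerivAt (fun σ => u (σ, x)) (fderiv ℝ u (τ, x) (1, 0)) τ :=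
    fun τ => hasDerivAt_slice_fst hud τ x
  have hcont : Continuous fun σ => u (σ, x) := hud.continuous.comp (Continuous.prodMk_left x)
  have hx0 : u (t₁, x) = 0 := h0 x ⟨by linarith [abs_nonneg (t - t₁)], by linarith [abs_nonneg (t - t₁)]⟩
  rcases le_or_gt t₁ t with h | h
  · have key := constant_of_has_deriv_right_zero (f := fun σ => u (σ, x)) (a := t₁) (b := t)
      hcont.continuousOn (fun τ hτ => by
        have hτ' : |τ - t₁| ≤ |t - t₁| := by
          rw [abs_of_nonneg (sub_nonneg.mpr hτ.1), abs_of_nonneg (sub_nonneg.mpr h)]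
          linarith [hτ.2]
        have := hg τ
        rw [hut τ hτ'] at this
        exact this.hasDerivWithinAt) t ⟨h, le_rfl⟩
    rw [key, hx0]
  · have key := constant_of_has_deriv_right_zero (f := fun σ => u (σ, x)) (a := t) (b := t₁)
      hcont.continuousOn (fun τ hτ => by
        have hτ' : |τ - t₁| ≤ |t - t₁| := by
          rw [abs_of_nonpos (sub_nonpos.mpr hτ.2.le), abs_of_neg (sub_neg.mpr h)]
          linarith [hτ.1]
        have := hg τ
        rw [hut τ hτ'] at this
        exact this.hasDerivWithinAt) t₁ ⟨h.le, le_rfl⟩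
    rw [← key, hx0]

/-- **Finite speed of propagation.** If the Cauchy data of a `C²` solution of
`u_tt − u_xx + V u = 0` (`V ≥ 0` differentiable) vanish on `[a, b]` at time `t₁` (`u = u_t = 0`
there), then `u` vanishes on the double triangle (future and past domain of dependence)
`{(t, x) | a + |t − t₁| ≤ x ≤ b − |t − t₁|}`. [folklore] -/
theorem eq_zero_of_data_eq_zero (hu : ContDiff ℝ 2 u) (hV : Differentiable ℝ V)
    (hV0 : ∀ x, 0 ≤ V x)
    (hsol : ∀ z : ℝ × ℝ, fderiv ℝ (fderiv ℝ u) z (1, 0) (1, 0)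
      - fderiv ℝ (fderiv ℝ u) z (0, 1) (0, 1) + V z.2 * u z = 0)
    {a b t₁ : ℝ} (h0 : ∀ x ∈ Icc a b, u (t₁, x) = 0)
    (h1 : ∀ x ∈ Icc a b, fderiv ℝ u (t₁, x) (1, 0) = 0) {t x : ℝ}
    (hx1 : a + |t - t₁| ≤ x) (hx2 : x ≤ b - |t - t₁|) : u (t, x) = 0 := by
  rcases (hx1.trans hx2).lt_or_eq with hlt | heq
  · exact eq_zero_of_data_eq_zero_of_lt hu hV hV0 hsol h0 h1 hlt hx1 hx2
  · -- apex: approximate from the levels strictly below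
    rcases (abs_nonneg (t - t₁)).lt_or_eq with hs | hs
    · have hcl : IsClosed {τ : ℝ | u (τ, x) = 0} :=
        isClosed_eq ((differentiable_of_contDiff_two hu).continuous.comp
          (Continuous.prodMk_left x)) continuous_const
      have hsub : Ioo (t₁ - |t - t₁|) (t₁ + |t - t₁|) ⊆ {τ : ℝ | u (τ, x) = 0} := by
        intro τ hτ
        have hτ : |τ - t₁| < |t - t₁| := abs_sub_lt_iff.mpr ⟨by linarith [hτ.2], by linarith [hτ.1]⟩
        exact eq_zero_of_data_eq_zero_of_lt hu hV hV0 hsol h0 h1 (t := τ) (by linarith)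
          (by linarith) (by linarith)
      have hcl' := hcl.closure_subset_iff.mpr hsub
      rw [closure_Ioo (by linarith)] at hcl'
      refine hcl' ⟨?_, ?_⟩
      · linarith [abs_le.mp (le_of_eq rfl : |t - t₁| ≤ |t - t₁|)]
      · linarith [abs_le.mp (le_of_eq rfl : |t - t₁| ≤ |t - t₁|)]
    · have ht : t = t₁ := by
        have := abs_eq_zero.mp hs.symm
        linarith
      subst ht
      exact h0 x ⟨by linarith [abs_nonneg (t - t)], by linarith [abs_nonneg (t - t)]⟩

/-- **Support stays inside the light cone (curried form).** For a `C²` solution `ψ : ℝ → ℝ → ℝ`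
of `ψ_tt − ψ_xx + V(x) ψ = 0` (`iteratedDeriv 2` of slices, as in the route decls; `V ≥ 0`
differentiable) whose Cauchy data at `t = 0` vanish outside the open interval `(xe, xc)` — the
data hypothesis of `BlindnessInsidePhotonSphere` —, `ψ t x = 0` whenever `xc + |t| ≤ x` or
`x ≤ xe − |t|`. [folklore] -/
theorem curried_eq_zero_outside_cone {V : ℝ → ℝ} (hV : Differentiable ℝ V) (hV0 : ∀ x, 0 ≤ V x)
    {ψ : ℝ → ℝ → ℝ} (hψ : ContDiff ℝ 2 (Function.uncurry ψ))
    (hsol : ∀ t x : ℝ, iteratedDeriv 2 (fun τ => ψ τ x) t - iteratedDeriv 2 (ψ t) x + V x * ψ t x = 0)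
    {xe xc : ℝ} (hdata : ∀ x, x ≤ xe ∨ xc ≤ x → ψ 0 x = 0 ∧ deriv (fun τ => ψ τ x) 0 = 0)
    {t x : ℝ} (hx : xc + |t| ≤ x ∨ x ≤ xe - |t|) : ψ t x = 0 := by
  have hsol' : ∀ z : ℝ × ℝ, fderiv ℝ (fderiv ℝ (Function.uncurry ψ)) z (1, 0) (1, 0)
      - fderiv ℝ (fderiv ℝ (Function.uncurry ψ)) z (0, 1) (0, 1)
      + V z.2 * Function.uncurry ψ z = 0 := by
    rintro ⟨t, x⟩
    rw [← iteratedDeriv_two_slice_fst_eq hψ, ← iteratedDeriv_two_slice_snd_eq hψ]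
    exact hsol t x
  have hd0 : ∀ y, y ≤ xe ∨ xc ≤ y → Function.uncurry ψ (0, y) = 0 := fun y hy => (hdata y hy).1
  have hd1 : ∀ y, y ≤ xe ∨ xc ≤ y → fderiv ℝ (Function.uncurry ψ) (0, y) (1, 0) = 0 := by
    intro y hy
    rw [← deriv_slice_fst_eq hψ]
    exact (hdata y hy).2
  show Function.uncurry ψ (t, x) = 0
  rcases hx with hx | hx
  · -- right of the cone: data vanish on `[xc, x + |t|]`
    refine eq_zero_of_data_eq_zero hψ hV hV0 hsol' (a := xc) (b := x + |t|) (t₁ := 0)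
      (fun y hy => hd0 y (Or.inr hy.1)) (fun y hy => hd1 y (Or.inr hy.1)) ?_ ?_
    · simpa using hx
    · simp
  · -- left of the cone: data vanish on `[x - |t|, xe]`
    refine eq_zero_of_data_eq_zero hψ hV hV0 hsol' (a := x - |t|) (b := xe) (t₁ := 0)
      (fun y hy => hd0 y (Or.inl hy.2)) (fun y hy => hd1 y (Or.inl hy.2)) ?_ ?_
    · simp
    · simpa using hx

end WaveEnergy

end

end Summit.FinalStateConjecture.FinalStateConjecture.Theorems
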